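import Summits.MatrixMultiplication.MatrixMultiplication.Theorems.AbelianSTPPCensusTAStatFSplit

/-!
# T_A static certificate, range `6780 … 6833` (multi-parameter k-member tree at `τ = 2371/1000`): kernel pieces of the cell `(14, 17, 17)` (volume `4046`) at the orders `6795 … 6797`, part 1/2

Cell mm-stpp (rung F-M1), tier T_A = «beat `2.371`, the record exponent (ADVXXZ'25 / DEK+26 rounded)»; seat mm-stpp-vp-p2 (gen 7).  Root-split layout (`AbelianSTPPCensusTAStatKMemberXSplit.lean`, `…XWalk.lean`, `AbelianSTPPCensusTAStatFSplit.lean`): the (cell, order) tree(s) have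
209478 nodes — beyond one `decide` — and is cut along list positions into `goIR` pieces / small subtrees / descent children of ≤ 4·10⁴ nodes each
(this file: 6 pieces, 140533 nodes; sizes from the exact twin seat twin/tastat9.py, kit j314549), assembled in `AbelianSTPPCensusTAStatFCkS4046o6795t6797.lean`.
`decide` with kernel reduction (standard axioms; no `native_decide`), `Elab.async false`.
WHAT THIS IS NOT: arithmetic on shape lists only; no statement about STPP families or `ω`.
-/

set_option linter.dupNamespace false
set_option autoImplicit false
set_option Elab.async false

namespace Summit.MatrixMultiplication.MatrixMultiplication.Theorems.TAStatF

open ShapeCert (gainOf2371j)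
open TECert (vol)

set_option maxHeartbeats 0 in
/-- root positions `0 … 4` (bucket `70`, order `6795`): 35433 nodes [original] -/
theorem s4046o6795b70rg0 : TAStatKM.goIR gainOf2371j 4046 (fun A' ms' => TAStatKM.treeKX tb m2l gainOf2371j (rowOf 4046) (xrowOf 4046) (gainOf2371j 4046) 765 4046 1482 14 238 6795 kmax 81 A' 70 ms') TAStatKM.agg0 (m2l 70) 0 5 = true := by decide +kernel

set_option maxHeartbeats 0 in
/-- root positions `5 … 165` (bucket `70`, order `6795`): 35332 nodes [original] -/
theorem s4046o6795b70rg1 : TAStatKM.goIR gainOf2371j 4046 (fun A' ms' => TAStatKM.treeKX tb m2l gainOf2371j (rowOf 4046) (xrowOf 4046) (gainOf2371j 4046) 765 4046 1482 14 238 6795 kmax 81 A' 70 ms') TAStatKM.agg0 (m2l 70) 5 161 = true := by decide +kernel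

set_option maxHeartbeats 0 in
/-- root descent child to bucket `69` (1 nodes) [original] -/
theorem s4046o6795b70rd : TAStatKM.treeKX tb m2l gainOf2371j (rowOf 4046) (xrowOf 4046) (gainOf2371j 4046) 765 4046 1482 14 238 6795 kmax 81 TAStatKM.agg0 69 (m2l 69) = true := by decide +kernel

set_option maxHeartbeats 0 in
/-- root positions `0 … 4` (bucket `70`, order `6796`): 35153 nodes [original] -/
theorem s4046o6796b70rg0 : TAStatKM.goIR gainOf2371j 4046 (fun A' ms' => TAStatKM.treeKX tb m2l gainOf2371j (rowOf 4046) (xrowOf 4046) (gainOf2371j 4046) 765 4046 1482 14 238 6796 kmax 81 A' 70 ms') TAStatKM.agg0 (m2l 70) 0 5 = true := by decide +kernel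

set_option maxHeartbeats 0 in
/-- root positions `5 … 165` (bucket `70`, order `6796`): 34613 nodes [original] -/
theorem s4046o6796b70rg1 : TAStatKM.goIR gainOf2371j 4046 (fun A' ms' => TAStatKM.treeKX tb m2l gainOf2371j (rowOf 4046) (xrowOf 4046) (gainOf2371j 4046) 765 4046 1482 14 238 6796 kmax 81 A' 70 ms') TAStatKM.agg0 (m2l 70) 5 161 = true := by decide +kernel

set_option maxHeartbeats 0 in
/-- root descent child to bucket `69` (1 nodes) [original] -/
theorem s4046o6796b70rd : TAStatKM.treeKX tb m2l gainOf2371j (rowOf 4046) (xrowOf 4046) (gainOf2371j 4046) 765 4046 1482 14 238 6796 kmax 81 TAStatKM.agg0 69 (m2l 69) = true := by decide +kernel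

end Summit.MatrixMultiplication.MatrixMultiplication.Theorems.TAStatF
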